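import Mathlib
import Summits.NavierStokesRegularity.NavierStokesRegularity.Theorems.EulerZoomLiouvillePowerGaugeEulerLiouvilleSelfSimilarSaddleContinuum
import Literature.Analysis.FluidPDE.SelfSimilarEulerStagnationStretching
import HarnessLib

/-!
# Rung C1 of the crux `EulerZoomLiouville.PowerGaugeEulerLiouville`: the BAD stagnation set is compact, and the
# saddle-continuum exclusion with the bad set itself as the continuum
# (route №10, item stmt-NavierStokesRegularity-19832; `--supports`)

Helper file (theorems only). Seat ns-typeII-p3 (cell ns-regularity-ideate §B, D-0081).  Sequel to
`…SelfSimilarSaddleContinuum` (`eq_zero_of_driftCoordinate_of_dominatedBlock_badNodes`: drift coordinate on a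
neighbourhood of `𝒩_W` + all BAD nodes inside a compact dominated-block piece `Kset` ⇒ `V ≡ 0`).  Here the auxiliary
compact set is removed: the bad set
`B = {z ∈ 𝒩_W : ∃ w, ‖w‖ = 1, ⟪DV(z) w, w⟫ ≥ 1}` (typeII-p1/p2's «bad nodes», the only stagnation points a vortical
particle can be backward-asymptotic to) is itself compact under the far field (3.8), so it can serve as `Kset`.

* `isCompact_badNodalSet` — `B` is compact (projection of the compact set
  `{(z, w) ∈ 𝒩_W × S² : ⟪DV(z)w, w⟫ ≥ 1}`);
* **`eq_zero_of_driftCoordinate_of_dominatedBlock_on_badSet`** — `0 < γ < ½`, `V` smooth with (3.8); a `C¹` drift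
  coordinate on an open `U ⊇ 𝒩_W`, injective on `𝒩_W`; and at EVERY BAD NODE the linearisation `γI + DV(z)` has the
  dominated real block form (`d₂ < 0`, `d₂ < d₀`, `d₂ < d₁` — e.g. typeII-p1 g7's degenerate portrait
  `(s + γ, 0, 2γ − s)`, `s ≥ 1`) ⇒ `V ≡ 0`, whatever the (possibly uncountable) stagnation set.

WHAT THIS IS NOT: not NS, not E, not rung C1 — the drift coordinate and the block data at bad nodes are HYPOTHESES.
[folklore; cf. ConstantinIgnatovaVicol2026Putative §3.5; Aulbach1984 Thm 2.3 (statement)]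
-/

noncomputable section

-- flat `Theorems/<Route><Decl>…` files of one crux share the namespace of the crux (tree convention)
set_option linter.dupNamespace false

open MeasureTheory Set Filter Topology Metric Function InnerProductSpace
open scoped RealInnerProductSpace NNReal ContDiff

namespace Summit.NavierStokesRegularity.NavierStokesRegularity.Theorems.PowerGaugeEulerLiouville.Kelvin

open Literature.Analysis Literature.Analysis.FluidPDE Literature.Dynamics.FixedPoints

variable {γ : ℝ} {V : EuclideanSpace ℝ (Fin 3) → EuclideanSpace ℝ (Fin 3)} {P : EuclideanSpace ℝ (Fin 3) → ℝ}

/-- **The bad stagnation set is compact** (`γ > 0`, (3.8), `V ∈ C¹` with continuous derivative):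
`{z ∈ 𝒩_W : ∃ w, ‖w‖ = 1 ∧ 1 ≤ ⟪DV(z)w, w⟫}` is the projection of the compact set
`{(z,w) ∈ 𝒩_W × S² : 1 ≤ ⟪DV(z)w, w⟫}`. [cite: ConstantinIgnatovaVicol2026Putative, §3.5 proof of Thm. 3.10 (compact nodal set)] -/
theorem isCompact_badNodalSet (hV : ContDiff ℝ ∞ V) (hγ : 0 < γ) {C : ℝ} (hfar : HasSelfSimilarFarFieldWith γ 0 C V) :
    IsCompact {z : EuclideanSpace ℝ (Fin 3) | z ∈ selfSimilarNodalSet γ 0 V ∧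
      ∃ w : EuclideanSpace ℝ (Fin 3), ‖w‖ = 1 ∧ 1 ≤ ⟪fderiv ℝ V z w, w⟫} := by
  have hNc : IsCompact (selfSimilarNodalSet γ 0 V) := hfar.isCompact_selfSimilarNodalSet hγ hV.continuous
  have hDVc : Continuous (fderiv ℝ V) := hV.continuous_fderiv (by simp)
  set S : Set (EuclideanSpace ℝ (Fin 3) × EuclideanSpace ℝ (Fin 3)) :=
    (selfSimilarNodalSet γ 0 V ×ˢ sphere (0 : EuclideanSpace ℝ (Fin 3)) 1) ∩
      {p | 1 ≤ ⟪fderiv ℝ V p.1 p.2, p.2⟫} with hS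
  have hSc : IsCompact S := by
    refine (hNc.prod (isCompact_sphere 0 1)).inter_right (isClosed_le continuous_const ?_)
    exact ((hDVc.comp continuous_fst).clm_apply continuous_snd).inner continuous_snd
  have heq : {z : EuclideanSpace ℝ (Fin 3) | z ∈ selfSimilarNodalSet γ 0 V ∧
      ∃ w : EuclideanSpace ℝ (Fin 3), ‖w‖ = 1 ∧ 1 ≤ ⟪fderiv ℝ V z w, w⟫} = Prod.fst '' S := by
    ext z
    constructor
    · rintro ⟨hz, w, hw1, hw⟩
      exact ⟨(z, w), ⟨⟨hz, by simpa using hw1⟩, hw⟩, rfl⟩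
    · rintro ⟨⟨z', w⟩, ⟨⟨hz, hw1⟩, hw⟩, rfl⟩
      exact ⟨hz, w, by simpa using hw1, hw⟩
  rw [heq]
  exact hSc.image continuous_fst

/-- **EXCLUSION FOR TRANSVERSALLY-SADDLE BAD SETS WITH DRIFT CONTROL (bad set as the continuum).**  Let `(V, P)` be
a classical self-similar Euler profile, `V` smooth, `0 < γ < ½`, with the far-field bounds (3.8).  Assume (i) an open
`U ⊇ 𝒩_W` carries a `C¹` drift coordinate `f` (`‖Df(y)W(y)‖ ≤ C‖W(y)‖²` on `U`) injective on `𝒩_W`, and (ii) at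
every BAD stagnation point (`1 ≤ ⟪DV(z)w, w⟫` for some unit `w`) the linearisation `γI + DV(z)` has the dominated
real block form (`d₂ < 0`, `d₂ < d₀`, `d₂ < d₁`).  Then `V ≡ 0`. [cite: ConstantinIgnatovaVicol2026Putative, §3.5 Thm 3.10 (strengthened to transversally-saddle stagnation continua with drift control); Robinson1999, Ch. V §5.10.1] -/
theorem eq_zero_of_driftCoordinate_of_dominatedBlock_on_badSet (hV : ContDiff ℝ ∞ V)
    (hprof : IsSelfSimilarEulerProfile γ 0 V P) (hγ : 0 < γ) (hγ2 : γ < 1 / 2)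
    {C₀ : ℝ} (hfar : HasSelfSimilarFarFieldWith γ 0 C₀ V)
    (hblock : ∀ z ∈ selfSimilarNodalSet γ 0 V,
      (∃ w : EuclideanSpace ℝ (Fin 3), ‖w‖ = 1 ∧ 1 ≤ ⟪fderiv ℝ V z w, w⟫) →
      ∃ (b : Module.Basis (Fin 3) ℝ (EuclideanSpace ℝ (Fin 3))) (lam : Fin 3 → ℝ) (β : ℝ),
        (γ • ContinuousLinearMap.id ℝ (EuclideanSpace ℝ (Fin 3)) + fderiv ℝ V z) (b 0) = lam 0 • b 0 - β • b 1 ∧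
        (γ • ContinuousLinearMap.id ℝ (EuclideanSpace ℝ (Fin 3)) + fderiv ℝ V z) (b 1) = β • b 0 + lam 1 • b 1 ∧
        (γ • ContinuousLinearMap.id ℝ (EuclideanSpace ℝ (Fin 3)) + fderiv ℝ V z) (b 2) = lam 2 • b 2 ∧
        lam 2 < 0 ∧ lam 2 < lam 0 ∧ lam 2 < lam 1)
    {U : Set (EuclideanSpace ℝ (Fin 3))} (hU : IsOpen U) (hNU : selfSimilarNodalSet γ 0 V ⊆ U)
    {F' : Type*} [NormedAddCommGroup F'] [NormedSpace ℝ F'] [CompleteSpace F']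
    {f : EuclideanSpace ℝ (Fin 3) → F'} (hf : ContDiff ℝ 1 f) {C : ℝ}
    (hdrift : ∀ y ∈ U, ‖fderiv ℝ f y (selfSimilarTransport γ 0 V y)‖ ≤ C * ‖selfSimilarTransport γ 0 V y‖ ^ 2)
    (hinj : InjOn f (selfSimilarNodalSet γ 0 V)) :
    V = 0 :=
  eq_zero_of_driftCoordinate_of_dominatedBlock_badNodes hV hprof hγ hγ2 hfar (isCompact_badNodalSet hV hγ hfar)
    (fun _ hz => hz.1) (fun _ hz hw => ⟨hz, hw⟩) (fun z hz => hblock z hz.1 hz.2) hU hNU hf hdrift hinj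

end Summit.NavierStokesRegularity.NavierStokesRegularity.Theorems.PowerGaugeEulerLiouville.Kelvin

end
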